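import Summits.BirchSwinnertonDyer.BirchSwinnertonDyer.Theorems.ClassRecordThreeCornerAtThreeShimuraSwapFamilyLevelRaising
import Summits.BirchSwinnertonDyer.BirchSwinnertonDyer.Theorems.ErratumRoadFiveNonSurjCornerKolyJSwapNamedFacts
import HarnessLib

/-!
# PORT-SPEC (P1), file 7: FAITHFULNESS CHECK of the family swap layer — the `X₀(N)` prime swap on the irreducible corner
# (`Swap.levelRaising_of_literature_of_irreducible`, this seat g11) RE-DERIVED through the family walk of file 4, with every item of
# the family dictionary instantiated by the tree's `KolyvaginHeegnerData` theorems along `toFamilyData`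
# (cell `bsd-stepL`, seat `bsd-stepL-corner-p1` g15; `--supports stmt-BirchSwinnertonDyer-21420 --as helper`)

WHY. Files 2–5 re-key bsd-jet's prime swap on `JET.KolyvaginFamilyData` with the `X₀(N)`-specific inputs turned into a DISPLAYED dictionary
(`hdata`, `hA`, `hP`, `hsign`, `hsel`, `h44`, `hmin`). A dictionary-shaped interface can be vacuous if mis-typed; THIS FILE certifies it is not:
on the `X₀(N)` datum (forgetful image `KolyvaginHeegnerData.toFamilyData`, tam3-p1 p592184) every dictionary item IS a tree theorem —
`hdata` (koly's `nonempty_kolyvaginHeegnerData_of_grossCM`; the point `y` of a Kolyvagin–Heegner datum is determined by `map_y`), `hA` (x11b3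
`NoTorsionIrr.isAdmissible_pointsSubgroup_of_hasIrreducibleModPGaloisRep`), `hP` (`KolyCert.toGeomPoints_derivedPoint_mem_invPoints_of_dvd_zhang`,
Gross 3.6), `hsign` (`Swap.sign_conjAct_kolyvaginClass_of_irreducible`, Gross 5.4), `hsel` (tam3-p1's
`Walk.rootClass_mem_selmerGroup_selmerF_of_levelUp_kolyvagin_of_admissible` with bsd-jet's `kolyvaginClass_mem_transverseKer` and [GZ86 III (3.1)]
image-free BY NAME), `h44` (this seat's `Prop44.addOrderOf_localization_kolyvaginClass_mul_eq_of_frobeniusCongruence_of_irr`, Gross 3.7 (2) BY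
NAME), the Čebotarev binder (`Koly.exists_kolyvaginPrime_addOrderOf_localization_eq_shift_of_irr_of_neg`, kernel) — and the family walk
`Swap.exists_conductor_fine_of_minDepth_family` then returns EXACTLY the statement of `Swap.levelRaising_of_literature_of_irreducible`
(`…KolyJSwapNamedFacts`, p-g11): **`exists_familyData_levelRaising_of_literature_of_irreducible`**, same hypotheses (the three named Literature
facts `hPT`, `hF1`, `h372`; `p ∉ {2,3}`, `E[p]` irreducible, `−1 ∈ ρ̄(Γ_ℚ)`, a disjointness prime), conclusion = the g11 conclusion with the
walk's FAMILY datum `dF` exhibited (`d.toFamilyData = dF`, non-divisibility read as `¬ dF.PDiv p (u+1)`; the dedup lint forbids a verbatim restatement). The bridge between a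
family datum `dm` with `dm.y = ys m` and a Kolyvagin–Heegner datum is `exists_toFamilyData_eq` (re-assemble the structure; `toFamilyData` of it
is `dm` by structure eta). HONEST FRAMING: theorems only, no definition ∕ fact ∕ sorry; CONDITIONAL on exactly the inputs of the g11 theorem it
re-derives (nothing new is claimed about any curve; the value is the CERTIFICATE that the family dictionary of files 4–5 is jointly
instantiable); no stub ∕ item closes; BSD is not proved by any of this; T7.
References (locators only): [cite: McCallumLMS1991, §5 Prop. 5.2 and proof (pp. 304–306), §4 Prop. 4.4] [cite: Jetchev2008, Lemma 5.1,
Lemma 5.2 (iii)] [cite: GrossLMS1991, Prop. 3.6, Prop. 3.7 (2), Prop. 5.4, §6 Prop. 6.2 (1)] [cite: GrossZagier1986, III (3.1)]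
[cite: MilneADT2006, Ch. I, Thm. 4.10(b)].
presearch: not applicable (re-derivation of a tree theorem). Design: no definitions; `K : Type`. Axioms: `propext`, `Classical.choice`, `Quot.sound`.
-/

set_option autoImplicit false

noncomputable section

open scoped Classical Pointwise
open Function NumberField IsDedekindDomain WeierstrassCurve Field
open Literature.NumberTheory.EllipticCurves Literature.NumberTheory.GaloisRepresentations
open Literature.NumberTheory.EllipticCurves.Jetchev2008 Literature.NumberTheory.EllipticCurves.KolyvaginCocycle
open Literature.NumberTheory.EllipticCurves.ModularForms
open Literature.NumberTheory.GaloisCohomology Literature.NumberTheory.Automorphic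
open Literature.NumberTheory.GaloisRepresentations.DiscreteGaloisModule (transverseSubgroup SelmerStructure)
open Summit.BirchSwinnertonDyer.Rank1Residual.JET.SelmerVocabulary
open Summit.BirchSwinnertonDyer.Rank1Residual.JET.GlobalDuality
open Summit.BirchSwinnertonDyer.Rank1Residual.X11b
open Summit.BirchSwinnertonDyer.Rank1Residual.X11b.Three
open Summit.BirchSwinnertonDyer.BirchSwinnertonDyer.Theorems
open Summit.BirchSwinnertonDyer.BirchSwinnertonDyer.Theorems.HeegnerE0ImageFree
open Summit.BirchSwinnertonDyer.BirchSwinnertonDyer.Theorems.ShimuraKolyvaginFixedOfTorsion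
open Summit.BirchSwinnertonDyer.Rank1Residual.X11b.Three.Koly

namespace Summit.BirchSwinnertonDyer.Rank1Residual.JET.Swap

/-! ### §1 A family datum with the Heegner point IS (the forgetful image of) a Kolyvagin–Heegner datum -/

/-- **The point of a Kolyvagin–Heegner datum is determined** (`map_y`: both map to `φ(x_n)` under the injective `E(K[n]) → E(ℂ)`).
[cite: GrossLMS1991, §3 (y_n)] -/
theorem heegnerData_y_eq {K : Type} [Field K] [NumberField K] {N : ℕ} [NeZero N] {W : WeierstrassCurve ℚ}
    {Dt : ModularParametrizationData W N} {β : ℤ} {ι : K →+* ℂ} {n : ℕ}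
    (d d' : KolyvaginHeegnerData Dt β ι n) : d.y = d'.y :=
  Affine.Point.map_injective (W' := W) (ringClassField K ι n).subtype.toRatAlgHom (d.map_y.trans d'.map_y.symm)

/-- **Re-assembly**: a family datum `dm` whose point is the Heegner point of some Kolyvagin–Heegner datum `d₀` of the same conductor IS
`dH.toFamilyData` for a Kolyvagin–Heegner datum `dH` (same `σ`, `S`, `emb`; `map_y` ∕ `dvd_sq_sub` from `d₀`; structure eta). [folklore] -/
theorem exists_toFamilyData_eq {K : Type} [Field K] [NumberField K] {N : ℕ} [NeZero N] {W : WeierstrassCurve ℚ}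
    {Dt : ModularParametrizationData W N} {β : ℤ} {ι : K →+* ℂ} {n : ℕ}
    (dm : KolyvaginFamilyData W K ι n) (d₀ : KolyvaginHeegnerData Dt β ι n) (h : dm.y = d₀.y) :
    ∃ d : KolyvaginHeegnerData Dt β ι n, d.toFamilyData = dm :=
  ⟨{ dvd_sq_sub := d₀.dvd_sq_sub, y := dm.y, map_y := by rw [h]; exact d₀.map_y, σ := dm.σ, zpowers_σ := dm.zpowers_σ,
     S := dm.S, S_subset := dm.S_subset, S_transversal := dm.S_transversal, emb := dm.emb, emb_apply := dm.emb_apply }, rfl⟩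

/-! ### §2 The X₀(N) prime swap on the irreducible corner, through the family walk -/

set_option maxHeartbeats 1600000 in
/-- **FAITHFULNESS CHECK — `Swap.levelRaising_of_literature_of_irreducible` re-derived through `Swap.exists_conductor_fine_of_minDepth_family`**
(statement = that of the g11 theorem with the walk's family datum `dF = d.toFamilyData` exhibited and `¬ dF.PDiv p (u+1)`; every dictionary item of the family walk instantiated by the tree's Kolyvagin–Heegner theorems
along `toFamilyData`; see the module docstring). CONDITIONAL on the same three named facts and frame hypotheses.
[cite: McCallumLMS1991, §5 Prop. 5.2 (p. 304)] [cite: Jetchev2008, Lemma 5.1, Lemma 5.2 (iii)] [cite: GrossZagier1986, III (3.1)] -/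
theorem exists_familyData_levelRaising_of_literature_of_irreducible
    (hPT : ∀ (K : Type) [Field K] [NumberField K], poitouTate_selmerStructure_duality_conj K)
    (hF1 : Gross1991_heegnerPoint_sub_ratTorsion_mem_E0_imageFree)
    (h372 : GrossLMS1991.prop37_2_frobeniusCongruence) :
    ∀ (W : WeierstrassCurve ℚ) [W.IsElliptic] [W.IsGloballyMinimal] [NeZero (W.conductorNorm ℤ)]
      (K : Type) [Field K] [NumberField K], IsImaginaryQuadratic K →
      NumberField.discr K ≠ -3 → NumberField.discr K ≠ -4 →
      SatisfiesHeegnerHypothesis (W.conductorNorm ℤ) K →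
      ∀ (p : ℕ) [Fact p.Prime], p ≠ 2 → p ≠ 3 → W.HasIrreducibleModPGaloisRep p → SatisfiesHeegnerHypothesis p K →
      (∃ γ : Field.absoluteGaloisGroup ℚ, ∀ P : geomTorsion W p, γ • P = -P) →
      ∀ {q₀ : ℕ}, q₀.Prime → (q₀ : ℤ) ∣ NumberField.discr K → ¬ q₀ ∣ W.conductorNorm ℤ → q₀ ≠ p →
      ∀ (Dt : ModularParametrizationData W (W.conductorNorm ℤ)) (β : ℤ) (ι : K →+* ℂ) (u : ℕ),
      (∀ (c : ℕ), Squarefree c →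
        (∀ q ∈ c.primeFactors, Zhang2014.IsKolyvaginPrime (W.conductorNorm ℤ) W K p q ∧
          1 + u ≤ Zhang2014.kolyvaginIndex W p q) →
        ∀ dc : KolyvaginHeegnerData Dt β ι c,
        ∃ Q : (W.baseChange (ringClassField K ι c)).toAffine.Point,
          ((p ^ u : ℕ) : ℤ) • Q = dc.derivedPoint) →
      ∀ (n₀ : ℕ), Squarefree n₀ →
        (∀ q ∈ n₀.primeFactors, Zhang2014.IsKolyvaginPrime (W.conductorNorm ℤ) W K p q ∧
          1 + u ≤ Zhang2014.kolyvaginIndex W p q) →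
        ∀ d₀ : KolyvaginHeegnerData Dt β ι n₀,
        (¬ ∃ Q : (W.baseChange (ringClassField K ι n₀)).toAffine.Point,
          ((p ^ (u + 1) : ℕ) : ℤ) • Q = d₀.derivedPoint) →
        ∀ m' : ℕ, ∃ (n : ℕ) (dF : KolyvaginFamilyData W K ι n) (d : KolyvaginHeegnerData Dt β ι n),
          d.toFamilyData = dF ∧ Squarefree n ∧
          (∀ q ∈ n.primeFactors, Zhang2014.IsKolyvaginPrime (W.conductorNorm ℤ) W K p q ∧
            max m' (1 + u) ≤ Zhang2014.kolyvaginIndex W p q) ∧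
          ¬ dF.PDiv p (u + 1) := by
  intro W _ _ _ K _ _ hK hD3 hD4 hH p _ hp2 hp3 hirr hHp hneg q₀ hq₀ hq₀d hq₀N hq₀p Dt β ι u hmin n₀ hn₀ hn₀K d₀ hd₀ m'
  have hp : p.Prime := Fact.out
  have hD : NumberField.discr K < -4 := KolyvaginAssembly.discr_lt_neg_four hK ⟨hD3, hD4⟩
  have hND : IsCoprime ((W.conductorNorm ℤ : ℕ) : ℤ) (NumberField.discr K) :=
    KolyvaginAssembly.isCoprime_discr_of_satisfiesHeegnerHypothesis hK hH
  have hCM1 : phi_heegnerPointOfConductor_mem_range_map_ringClassField (W.conductorNorm ℤ) W K :=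
    phi_heegnerPointOfConductor_mem_range_map_ringClassField_holds (W.conductorNorm ℤ) W K
  have hCM2 : exists_generator_ringClassGalOver K := exists_generator_ringClassGalOver_holds
  haveI : ∀ j : ℕ, NumberField (ringClassField K ι j) := numberField_ringClassField K hK ι
  obtain ⟨τ, hτ⟩ := exists_algEquiv_ne_one_of_isImaginaryQuadratic K hK
  have hττ : τ * τ = 1 := mul_self_eq_one_of_isImaginaryQuadratic hK τ
  -- ### the pool (Zhang) and the target
  let KP : ℕ → Prop := fun q ↦ Zhang2014.IsKolyvaginPrime (W.conductorNorm ℤ) W K p q ∧ 1 + u ≤ Zhang2014.kolyvaginIndex W p q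
  let Fine : ℕ → Prop := fun q ↦ max m' (1 + u) ≤ Zhang2014.kolyvaginIndex W p q
  -- ### Kolyvagin–Heegner data on the pool, the family `ys` of their (well-defined) points, re-assembly
  have hne : ∀ m : ℕ, Squarefree m → (∀ q ∈ m.primeFactors, KP q) → Nonempty (KolyvaginHeegnerData Dt β ι m) :=
    fun m hm hmKP ↦ nonempty_kolyvaginHeegnerData_of_grossCM hCM1 hCM2 hK hH Dt β ι d₀.dvd_sq_sub hm
      (fun q hq ↦ (hmKP q hq).1.2.2.2.2.1)
  let ys : (m : ℕ) → (W.baseChange (ringClassField K ι m)).toAffine.Point := fun m ↦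
    if h : Nonempty (KolyvaginHeegnerData Dt β ι m) then (Classical.choice h).y else 0
  have hys : ∀ {m : ℕ} (d : KolyvaginHeegnerData Dt β ι m), d.y = ys m := by
    intro m d
    simp only [ys, dif_pos (⟨d⟩ : Nonempty (KolyvaginHeegnerData Dt β ι m))]
    exact heegnerData_y_eq d _
  have hlift : ∀ {m : ℕ} (dm : KolyvaginFamilyData W K ι m), dm.y = ys m → Squarefree m → (∀ q ∈ m.primeFactors, KP q) →
      ∃ d : KolyvaginHeegnerData Dt β ι m, d.toFamilyData = dm := by
    intro m dm hdm hm hmKP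
    obtain ⟨d₁⟩ := hne m hm hmKP
    exact exists_toFamilyData_eq dm d₁ (hdm.trans (hys d₁).symm)
  -- ### admissibility (x11b3 `NoTorsionIrr`) and invariance (Gross 3.6) for every datum on the pool
  have hAof : ∀ {m : ℕ}, Squarefree m → (∀ q ∈ m.primeFactors, KP q) → ∀ (d : KolyvaginHeegnerData Dt β ι m) (M : ℕ),
      IsAdmissible (absoluteGaloisGroup K) d.pointsSubgroup ((p ^ M : ℕ) : ℤ) :=
    fun hm hmKP d M ↦ NoTorsionIrr.isAdmissible_pointsSubgroup_of_hasIrreducibleModPGaloisRep d hK hm.ne_zero hp hp2 hirr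
      (W.exists_weilPairing_holds p) (isUnramifiedIn_of_satisfiesHeegnerHypothesis_of_dvd hK hHp hp (dvd_refl p))
      (Koly.not_dvd_of_forall_isKolyvaginPrime W hm.ne_zero fun q hq ↦ (hmKP q hq).1) M
  have hPof : ∀ {m : ℕ} (hm : Squarefree m) (hmKP : ∀ q ∈ m.primeFactors, KP q) (d : KolyvaginHeegnerData Dt β ι m),
      d.toGeomPoints d.derivedPoint ∈ invPoints (absoluteGaloisGroup K) d.pointsSubgroup ((p ^ (1 + u) : ℕ) : ℤ) := by
    intro m hm hmKP d
    have hne' : ∀ m' : ℕ, m' ∣ m → Nonempty (KolyvaginHeegnerData Dt β ι m') := fun m' hm' ↦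
      nonempty_kolyvaginHeegnerData_of_grossCM hCM1 hCM2 hK hH Dt β ι d.dvd_sq_sub (hm.squarefree_of_dvd hm')
        (fun q hq ↦ (hmKP q (Nat.primeFactors_mono hm' hm.ne_zero hq)).1.2.2.2.2.1)
    let data : (m' : ℕ) → m' ∣ m → KolyvaginHeegnerData Dt β ι m' := fun m' hm' ↦
      if h : m' = m then h ▸ d else (hne' m' hm').some
    have hdata : data m dvd_rfl = d := by simp [data]
    have h := KolyCert.toGeomPoints_derivedPoint_mem_invPoints_of_dvd_zhang hK ι Dt hp hND hD hm hmKP data m dvd_rfl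
    rwa [hdata] at h
  -- ### the level-`p` structural packages (bsd-jet's block, verbatim)
  haveI : NeZero (p ^ 1) := ⟨pow_ne_zero 1 hp.ne_zero⟩
  haveI : Finite (geomTorsion (W.baseChange K) ((p ^ 1 : ℕ) : ℤ)) :=
    finite_geomTorsion_of_neZero (W.baseChange K) (p ^ 1)
  obtain ⟨inv, hperf, hvan, -, hSC, hconj⟩ := hPT K (p ^ 1)
  have h2 : 2 ≤ p ^ 1 := by rw [pow_one]; exact hp.two_le
  obtain ⟨ew, hμw, hadd₁, hadd₂, hgal, halt, hnondeg, hτe⟩ := exists_weilDatum_liftAut W τ (p ^ 1) h2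
  obtain ⟨𝒯, h𝒯, -⟩ := Walk.exists_globalTransverseFamily W ι ((p ^ 1 : ℕ) : ℤ)
  have h𝒯σ' : ∀ (c : ℕ), Squarefree c →
      (∀ q ∈ c.primeFactors, Zhang2014.IsKolyvaginPrime (W.conductorNorm ℤ) W K p q) →
      ∀ (v w : HeightOneSpectrum (𝓞 K)) (h : τ • v = w), v ∈ placesDividing K c →
      ∀ x : galoisCohomology (((W.baseChange K).torsionGaloisModule ((p ^ 1 : ℕ) : ℤ)).toLocal
        (Sum.inr v : Place K)) 1,
      x ∈ 𝒯 (Sum.inr v) → conjActPlace W τ ((p ^ 1 : ℕ) : ℤ) h x ∈ 𝒯 (Sum.inr w) :=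
    fun c hc _ v w h hv x hx ↦ Walk.globalTransverse_conjActPlace_mem h𝒯 τ hc
      (forall_conjActPlace_mem_of_eq_iInf_transverseSubgroup W hK ι τ _ c) v w h hv x hx
  have h𝒯sd' : ∀ (c : ℕ), Squarefree c →
      (∀ q ∈ c.primeFactors, Zhang2014.IsKolyvaginPrime (W.conductorNorm ℤ) W K p q) →
      ∀ v ∈ placesDividing K c,
      inv.dualTransported 𝒯 (weilDualIntertwining (W.baseChange K) (p ^ 1) ew hμw hadd₁ hadd₂ hgal)
        (Sum.inr v) = 𝒯 (Sum.inr v) :=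
    fun c hc hcK ↦ Walk.globalTransverse_dualTransported_eq (ι := ι) h𝒯 hc
      (fun 𝒯c h𝒯c inv' hperf' w' hw' ↦
        RingClassTransverse.dualTransported_eq_of_localTransverseFamily W K hK hD ι p hp2 1 le_rfl c hc
          hcK (fun ℓ hℓ ↦ (hcK ℓ hℓ).2.2.2.2.2) 𝒯c h𝒯c ew hμw hadd₁ hadd₂ hgal halt hnondeg inv' hperf' w' hw')
      inv hperf
  have hloc' : ∀ ℓ : ℕ, Zhang2014.IsKolyvaginPrime (W.conductorNorm ℤ) W K p ℓ →
      1 ≤ Zhang2014.kolyvaginIndex W p ℓ →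
      ∀ (v : HeightOneSpectrum (𝓞 K)), (ℓ : 𝓞 K) ∈ v.asIdeal → ∀ (hfix : τ • v = v) (s : ℤ),
      (s = 1 ∨ s = -1) →
      ((W.baseChange K).kummerSelmerStructure ((p ^ 1 : ℕ) : ℤ) (Sum.inr v)).relIndex
        ((conjActPlace W τ ((p ^ 1 : ℕ) : ℤ) hfix - s • AddMonoidHom.id _).ker) = p ^ 1 :=
    fun ℓ hℓ hk v hv hfix s hs ↦
      kolyvaginLocalTerm_of_poitouTate hPT W K hK τ hτ p 1 hp2 le_rfl ℓ hℓ hk v hv hfix s hs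
  have hdisj' : ∀ ℓ : ℕ, Zhang2014.IsKolyvaginPrime (W.conductorNorm ℤ) W K p ℓ →
      ∀ v : HeightOneSpectrum (𝓞 K), (ℓ : 𝓞 K) ∈ v.asIdeal →
      Disjoint ((W.baseChange K).kummerSelmerStructure ((p ^ 1 : ℕ) : ℤ) (Sum.inr v)) (𝒯 (Sum.inr v)) :=
    fun ℓ hℓ v hv ↦ Walk.globalTransverse_disjoint_kummer h𝒯
      (P := fun ℓ ↦ Zhang2014.IsKolyvaginPrime (W.conductorNorm ℤ) W K p ℓ)
      (fun ℓ hℓ w hw ↦ Walk.disjoint_kummer_iInf_transverseSubgroup W K hK hD ι 1 hℓ w hw)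
      (fun ℓ hℓ ↦ hℓ.1) ℓ hℓ v hv
  -- [GZ86 III (3.1)] image-free, in the Kolyvagin-scoped receptacle form
  obtain ⟨n', hcop', hGZ'⟩ := forall_hGZ_of_Gross1991_imageFree hF1 W K hK hD3 hD4 hH p hp2 hirr Dt β ι
  -- ### the family walk
  obtain ⟨n, d, hdy, hn, hnF, hnd⟩ := exists_conductor_fine_of_minDepth_family W τ p ew hμw hadd₁ hadd₂ hgal halt hnondeg
    hτe hK hp2 hττ ys inv hperf hvan hSC (hconj τ) 𝒯 h𝒯σ' h𝒯sd' hloc' hdisj'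
    (torsionBy_eq_bot_of_isImaginaryQuadratic_of_hasIrreducibleModPGaloisRep W K hK hp hirr) KP Fine (fun q hq ↦ hq)
    (fun e₁ he₁ x y hx hy hy0 b ↦ by
      obtain ⟨ℓ, hbℓ, hKol, hidx, hord⟩ := exists_kolyvaginPrime_addOrderOf_localization_eq_shift_of_irr_of_neg W hK hp2 hirr
        hneg hq₀ hq₀d hq₀N hq₀p τ hτ (k := 1) le_rfl (max m' u) he₁ x y hx hy hy0 b
      refine ⟨ℓ, hbℓ, ⟨hKol, by omega⟩, ?_, hord⟩
      change max m' (1 + u) ≤ Zhang2014.kolyvaginIndex W p ℓ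
      omega)
    (fun m hm hmKP ↦ by
      obtain ⟨d₁⟩ := hne m hm hmKP
      exact ⟨d₁.toFamilyData, hys d₁⟩)
    (fun m dm hdm hm hmKP ↦ by
      obtain ⟨dH, rfl⟩ := hlift dm hdm hm hmKP
      exact hAof hm hmKP dH (1 + u))
    (fun m dm hdm hm hmKP ↦ by
      obtain ⟨dH, rfl⟩ := hlift dm hdm hm hmKP
      exact hPof hm hmKP dH)
    (εf := -W.rootNumber) (by rcases W.rootNumber_eq_one_or with h1 | h1 <;> simp [h1])
    (fun m dm hdm hm hmKP ↦ by
      obtain ⟨dH, rfl⟩ := hlift dm hdm hm hmKP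
      exact (sign_conjAct_kolyvaginClass_of_irreducible hK hD3 hD4 hH hp2 hirr hHp τ hτ Dt β ι hm (k := 1 + u) (by omega)
        hmKP dH).2)
    (fun m dm hdm hm hmKP Q hA1 hQ hQP ↦ by
      obtain ⟨dH, rfl⟩ := hlift dm hdm hm hmKP
      exact Walk.rootClass_mem_selmerGroup_selmerF_of_levelUp_kolyvagin_of_admissible W h𝒯 hK hD3 hD4 hH hcop' hGZ' hm hmKP dH
        Q hA1 hQ hQP (hAof hm hmKP dH (1 + u))
        (fun m₁ hm₁ dm₁ ↦ NoTorsionIrr.isAdmissible_pointsSubgroup_of_hasIrreducibleModPGaloisRep dm₁ hK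
          (hm.squarefree_of_dvd hm₁).ne_zero hp hp2 hirr (W.exists_weilPairing_holds p)
          (isUnramifiedIn_of_satisfiesHeegnerHypothesis_of_dvd hK hHp hp (dvd_refl p))
          (Koly.not_dvd_of_forall_isKolyvaginPrime W (hm.squarefree_of_dvd hm₁).ne_zero
            fun q hq ↦ (hmKP q (Nat.primeFactors_mono hm₁ hm.ne_zero hq)).1) (1 + u))
        (hPof hm hmKP dH) (fun ℓ hℓ ↦ kolyvaginClass_mem_transverseKer W hK hD hp2 Dt β ι (1 + u) hm hmKP dH hℓ))
    (fun m l hml hl hlm hmlKP dm dml hdm hdml v hv ↦ by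
      have hmKP : ∀ q ∈ m.primeFactors, KP q := fun q hq ↦
        hmlKP q (Nat.primeFactors_mono (Dvd.intro l rfl) hml.ne_zero hq)
      obtain ⟨dH, rfl⟩ := hlift dm hdm (hml.squarefree_of_dvd (Dvd.intro l rfl)) hmKP
      obtain ⟨dHl, rfl⟩ := hlift dml hdml hml hmlKP
      exact Prop44.addOrderOf_localization_kolyvaginClass_mul_eq_of_frobeniusCongruence_of_irr h372 hK hD3 hD4 hH hp2 hp3 hHp
        hirr Dt β ι (1 + u) (by omega) m l hml hl hlm hmlKP dH dHl v hv)
    (fun m dm hdm hm hmKP ↦ by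
      obtain ⟨dH, rfl⟩ := hlift dm hdm hm hmKP
      exact hmin m hm hmKP dH)
    hn₀ hn₀K d₀.toFamilyData (hys d₀) hd₀
  -- ### read back: the family datum of the walk IS (the forgetful image of) a Kolyvagin–Heegner datum
  obtain ⟨dH, hdH⟩ := hlift d hdy hn (fun q hq ↦ (hnF q hq).1)
  exact ⟨n, d, dH, hdH, hn, fun q hq ↦ ⟨(hnF q hq).1.1, (hnF q hq).2⟩, hnd⟩

end Summit.BirchSwinnertonDyer.Rank1Residual.JET.Swap

end
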